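import Summits.HodgeConjecture.CorCM.Census.QuaternionColumnChains
import Summits.HodgeConjecture.CorCM.Census.QuaternionColumnPotential

/-!
# The quaternion column, V: the explicit face family of plan S — members, corners, and the far set it leaves to the generic covering

COR-CM (cell `pub-hodgecm2`), count-neutral kernel combinatorics by the binder seat b09 (gen 39; lane QUATERNION COLUMN), part V, on parts
I–IV (`Census/QuaternionColumn{Biarc,Circle,Chains,Potential}.lean`) and parts C/M (`bpot`, `blk_ne_of_bpot_lt`, `bpot_oflipCM_rt_le_one`)
used BY NAME.  Bookkeeping definitions with bodies (the five explicit face families `famA … famCc`, their union `qfam`, the three explicitly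
covered block families `blkA, blkB, blkC`) + theorems; no `decide`, no certificate, no named fact, no `sorry`.
HONEST FRAMING: `HC_CM` is NOT proved, here or anywhere in the tree; nothing here is a period or a headline.

THE FAMILY (numerics `HOME/pub-hodgecm2-b09/lean-g39/py2/qplan.py`, `n = 4, 8, 16`: full rank, index `2^{2n−1}`, fibre-independent).
With `T₀ = barc 0 0`:
* `famA = {fplus k 0 : k < n}` — the `n` biarc faces (one per biarc block `BA_s`, `s = k`);
* `famBf = {f_i = gface T₀ (a i) (xa (−1)) : 1 ≤ i ≤ n−2}`, `famBc = {c_i = gface T₀ (a 0) (a (i+1)) : 1 ≤ i ≤ n−2}` — the rotation chain;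
* `famCf = {f'_j = gface T₀ (xa j) (xa (−1)) : 1 ≤ j ≤ n−2}`, `famCc = {c'_j = gface T₀ (a 0) (xa (j+1)) : 1 ≤ j ≤ n−3}` — the reflection chain.
`qfam` is their union (`5n − 9` faces for `n ≥ 3`).  The blocks it covers explicitly: `blkA = {BA_k : 2 ≤ k ≤ n−2}` (far biarc blocks),
`blkB = {blk C_i}`, `blkC = {blk C'_j}` (the coincidence blocks of the chains, `C_i = T₀^{(a 0)(a (i+1))}`, `C'_j = T₀^{(a 0)(xa (j+1))}`).
§1 membership in `qfam` in the shape of the hypotheses of parts II–III (`fplus_mem_qfam`, …) and `qfam ⊆ gfaceSet`; §2 every corner of every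
member of `qfam` is RESIDUAL (potential `≤ 1`) or lies in an explicitly covered block (`corner lemmas`), whence §3 (`par_qfam_eq_zero_of_far`):
the block parities of `qfam` VANISH on every block of potential `≥ 2` outside `blkA ∪ blkB ∪ blkC` — the hypothesis `hfar₁` of
`BaseBlock.exists_joint_cover_on` (`Census/BaseBlockCoveringOn.lean`).  Part VI assembles the law.

## References
* [Pohlmann1968] H. Pohlmann, Algebraic cycles on abelian varieties of complex multiplication type, Ann. of Math. 88 (1968), Thm 1.
-/

namespace Summit.HodgeConjecture.CorCM.Census.QuaternionColumn

open Finset QuaternionGroup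
open Summit.HodgeConjecture.CorCM.Prior.AllgGroup.RfwfAllgGroup
open Summit.HodgeConjecture.CorCM.Census.BlockParity
open Summit.HodgeConjecture.CorCM.Census.Coinvariant
open Summit.HodgeConjecture.CorCM.Census.BaseBlock
open Summit.HodgeConjecture.CorCM.Census.TwistGeneration

noncomputable section

variable {n : ℕ} [NeZero n]

/-! ## §1 The five families and their union -/

/-- The biarc faces `fplus k 0`, `k < n`. [folklore] -/
def famA (n : ℕ) [NeZero n] : Finset (CMF (QuaternionGroup n) (c n) →₀ ℤ) :=
  (range n).image fun k : ℕ => fplus (k : ZMod (2 * n)) 0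

/-- The rotation chain faces `f_i = gface T₀ (a i) (xa (−1))`, `1 ≤ i ≤ n−2`. [folklore] -/
def famBf (n : ℕ) [NeZero n] : Finset (CMF (QuaternionGroup n) (c n) →₀ ℤ) :=
  (Ico 1 (n - 1)).image fun i : ℕ => gface (c n) c_mul_c (barc 0 0) (a (i : ZMod (2 * n))) (xa (-1))

/-- The rotation chain covers `c_i = gface T₀ (a 0) (a (i+1))`, `1 ≤ i ≤ n−2`. [folklore] -/
def famBc (n : ℕ) [NeZero n] : Finset (CMF (QuaternionGroup n) (c n) →₀ ℤ) :=
  (Ico 1 (n - 1)).image fun i : ℕ => gface (c n) c_mul_c (barc 0 0) (a 0) (a ((i : ZMod (2 * n)) + 1))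

/-- The reflection chain faces `f'_j = gface T₀ (xa j) (xa (−1))`, `1 ≤ j ≤ n−2`. [folklore] -/
def famCf (n : ℕ) [NeZero n] : Finset (CMF (QuaternionGroup n) (c n) →₀ ℤ) :=
  (Ico 1 (n - 1)).image fun j : ℕ => gface (c n) c_mul_c (barc 0 0) (xa (j : ZMod (2 * n))) (xa (-1))

/-- The reflection chain covers `c'_j = gface T₀ (a 0) (xa (j+1))`, `1 ≤ j ≤ n−3`. [folklore] -/
def famCc (n : ℕ) [NeZero n] : Finset (CMF (QuaternionGroup n) (c n) →₀ ℤ) :=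
  (Ico 1 (n - 2)).image fun j : ℕ => gface (c n) c_mul_c (barc 0 0) (a 0) (xa ((j : ZMod (2 * n)) + 1))

/-- **The explicit face family of plan S.** [folklore] -/
def qfam (n : ℕ) [NeZero n] : Finset (CMF (QuaternionGroup n) (c n) →₀ ℤ) :=
  famA n ∪ (famBf n ∪ famBc n) ∪ (famCf n ∪ famCc n)

/-- The biarc faces are members. [folklore] -/
theorem fplus_mem_qfam (k : ℕ) (hk : k < n) : fplus (k : ZMod (2 * n)) 0 ∈ qfam n :=
  mem_union_left _ (mem_union_left _ (mem_image.mpr ⟨k, mem_range.mpr hk, rfl⟩))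

/-- The rotation chain faces are members. [folklore] -/
theorem f_mem_qfam (i : ℕ) (h1 : 1 ≤ i) (h2 : i + 2 ≤ n) :
    gface (c n) c_mul_c (barc 0 0) (a (i : ZMod (2 * n))) (xa (-1)) ∈ qfam n :=
  mem_union_left _ (mem_union_right _ (mem_union_left _ (mem_image.mpr ⟨i, mem_Ico.mpr ⟨h1, by omega⟩, rfl⟩)))

/-- The rotation chain covers are members. [folklore] -/
theorem c_mem_qfam (i : ℕ) (h1 : 1 ≤ i) (h2 : i + 2 ≤ n) :
    gface (c n) c_mul_c (barc 0 0) (a 0) (a ((i : ZMod (2 * n)) + 1)) ∈ qfam n :=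
  mem_union_left _ (mem_union_right _ (mem_union_right _ (mem_image.mpr ⟨i, mem_Ico.mpr ⟨h1, by omega⟩, rfl⟩)))

/-- The reflection chain faces are members. [folklore] -/
theorem f'_mem_qfam (j : ℕ) (h1 : 1 ≤ j) (h2 : j + 2 ≤ n) :
    gface (c n) c_mul_c (barc 0 0) (xa (j : ZMod (2 * n))) (xa (-1)) ∈ qfam n :=
  mem_union_right _ (mem_union_left _ (mem_image.mpr ⟨j, mem_Ico.mpr ⟨h1, by omega⟩, rfl⟩))

/-- The reflection chain covers are members. [folklore] -/
theorem c'_mem_qfam (j : ℕ) (h1 : 1 ≤ j) (h2 : j + 3 ≤ n) :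
    gface (c n) c_mul_c (barc 0 0) (a 0) (xa ((j : ZMod (2 * n)) + 1)) ∈ qfam n :=
  mem_union_right _ (mem_union_right _ (mem_image.mpr ⟨j, mem_Ico.mpr ⟨h1, by omega⟩, rfl⟩))

omit [NeZero n] in
/-- Two rotations are in distinct places unless their indices agree or differ by `n`. [folklore] -/
theorem a_notMem_orb_a {i j : ZMod (2 * n)} (h1 : i ≠ j) (h2 : i ≠ j + (n : ZMod (2 * n))) :
    (a i : QuaternionGroup n) ∉ orb (c n) (a j) := by
  rw [mem_orb, (c_mul_a j).1]
  rintro (h | h)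
  · exact h1 (QuaternionGroup.a.inj h)
  · exact h2 (QuaternionGroup.a.inj h)

omit [NeZero n] in
/-- Two reflections are in distinct places unless their indices agree or differ by `n`. [folklore] -/
theorem xa_notMem_orb_xa {i j : ZMod (2 * n)} (h1 : i ≠ j) (h2 : i ≠ j + (n : ZMod (2 * n))) :
    (xa i : QuaternionGroup n) ∉ orb (c n) (xa j) := by
  rw [mem_orb, (c_mul_a j).2]
  rintro (h | h)
  · exact h1 (QuaternionGroup.xa.inj h)
  · exact h2 (QuaternionGroup.xa.inj h)

omit [NeZero n] in
/-- `val` of a small natural number cast into `ℤ/2n`. [folklore] -/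
theorem val_natCast_of_lt {k : ℕ} (hk : k < 2 * n) : ((k : ℕ) : ZMod (2 * n)).val = k := ZMod.val_cast_of_lt hk

omit [NeZero n] in
/-- Distinct naturals below `2n` are distinct in `ℤ/2n`. [folklore] -/
theorem natCast_ne_of_lt {i j : ℕ} (hi : i < 2 * n) (hj : j < 2 * n) (hij : i ≠ j) : ((i : ℕ) : ZMod (2 * n)) ≠ (j : ℕ) := by
  intro h
  have h' := congrArg ZMod.val h
  rw [ZMod.val_cast_of_lt hi, ZMod.val_cast_of_lt hj] at h'
  exact hij h'

/-- `−1 = (2n − 1 : ℕ)` in `ℤ/2n`. [folklore] -/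
theorem neg_one_eq_natCast : (-1 : ZMod (2 * n)) = ((2 * n - 1 : ℕ) : ℕ) := by
  have hn := NeZero.ne n
  have h : (((2 * n - 1 : ℕ) : ℕ) : ZMod (2 * n)) + 1 = 0 := by
    rw [← Nat.cast_succ, Nat.succ_eq_add_one, show 2 * n - 1 + 1 = 2 * n by omega, ZMod.natCast_self]
  linear_combination (-1 : ZMod (2 * n)) * h

/-- **`qfam ⊆ gfaceSet`** (every member is a face at two distinct places). [folklore] -/
theorem qfam_subset_gfaceSet (h3 : 3 ≤ n) : (↑(qfam n) : Set (CMF (QuaternionGroup n) (c n) →₀ ℤ)) ⊆ gfaceSet (QuaternionGroup n) (c n) c_mul_c := by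
  intro f hf
  rw [mem_coe, qfam, mem_union, mem_union, mem_union, mem_union] at hf
  rcases hf with (hf | hf | hf) | hf | hf
  · obtain ⟨k, -, rfl⟩ := mem_image.mp hf
    exact fplus_mem_gfaceSet _ _
  · obtain ⟨i, -, rfl⟩ := mem_image.mp hf
    exact ⟨_, _, _, xa_notMem_orb_a _ _, rfl⟩
  · obtain ⟨i, hi, rfl⟩ := mem_image.mp hf
    rw [mem_Ico] at hi
    refine ⟨_, _, _, a_notMem_orb_a ?_ ?_, rfl⟩
    · rw [← Nat.cast_zero (R := ZMod (2 * n)), ← Nat.cast_succ]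
      exact (natCast_ne_of_lt (n := n) (by omega) (by omega) (by omega)).symm
    · rw [← Nat.cast_succ, zero_add]
      exact (natCast_ne_of_lt (n := n) (by omega) (by omega) (by omega)).symm
  · obtain ⟨j, hj, rfl⟩ := mem_image.mp hf
    rw [mem_Ico] at hj
    refine ⟨_, _, _, xa_notMem_orb_xa ?_ ?_, rfl⟩
    · rw [neg_one_eq_natCast]
      exact natCast_ne_of_lt (n := n) (by omega) (by omega) (by omega)
    · rw [neg_one_eq_natCast, ← Nat.cast_add]
      exact natCast_ne_of_lt (n := n) (by omega) (by omega) (by omega)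
  · obtain ⟨j, hj, rfl⟩ := mem_image.mp hf
    rw [mem_Ico] at hj
    exact ⟨_, _, _, xa_notMem_orb_a _ _, rfl⟩

/-! ## §2 The explicitly covered blocks and the corners of the family -/

open Classical in
/-- The far biarc blocks `BA_k = blk (barc k 0)`, `2 ≤ k ≤ n−2`. [folklore] -/
def blkA (n : ℕ) [NeZero n] : Finset (Block (c n)) := (Ico 2 (n - 1)).image fun k : ℕ => blk (c n) (barc (k : ZMod (2 * n)) 0)

open Classical in
/-- The coincidence blocks of the rotation chain `blk C_i`, `C_i = T₀^{(a 0)(a (i+1))}`, `1 ≤ i ≤ n−2`. [folklore] -/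
def blkB (n : ℕ) [NeZero n] : Finset (Block (c n)) :=
  (Ico 1 (n - 1)).image fun i : ℕ => blk (c n) (oflipCM (c n) c_mul_c (a 0) (oflipCM (c n) c_mul_c (a ((i : ZMod (2 * n)) + 1)) (barc 0 0)))

open Classical in
/-- The coincidence blocks of the reflection chain `blk C'_j`, `C'_j = T₀^{(a 0)(xa (j+1))}`, `1 ≤ j ≤ n−3`. [folklore] -/
def blkC (n : ℕ) [NeZero n] : Finset (Block (c n)) :=
  (Ico 1 (n - 2)).image fun j : ℕ => blk (c n) (oflipCM (c n) c_mul_c (a 0) (oflipCM (c n) c_mul_c (xa ((j : ZMod (2 * n)) + 1)) (barc 0 0)))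

/-- **Near-or-explicit types miss every far block**: if `Ψ` is residual or its block is explicitly covered, then `blk Ψ ≠ B` for every block `B`
of potential `≥ 2` outside `blkA ∪ blkB ∪ blkC`. [folklore] -/
theorem blk_ne_of_nx {Ψ : CMF (QuaternionGroup n) (c n)} (hΨ : bpot (c n) (barc 0 0) Ψ ≤ 1 ∨ blk (c n) Ψ ∈ blkA n ∪ blkB n ∪ blkC n)
    {B : Block (c n)} (hB : 2 ≤ bpot (c n) (barc 0 0) B.out ∧ B ∉ blkA n ∪ blkB n ∪ blkC n) : blk (c n) Ψ ≠ B := by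
  rintro rfl
  rcases hΨ with h | h
  · rw [bpot_out] at hB; omega
  · exact hB.2 h

/-- Near-or-explicit is a block property (invariant under base change). [folklore] -/
theorem nx_rt {Ψ : CMF (QuaternionGroup n) (c n)} (hΨ : bpot (c n) (barc 0 0) Ψ ≤ 1 ∨ blk (c n) Ψ ∈ blkA n ∪ blkB n ∪ blkC n)
    (Q : QuaternionGroup n) : bpot (c n) (barc 0 0) (rt (c n) Q Ψ) ≤ 1 ∨ blk (c n) (rt (c n) Q Ψ) ∈ blkA n ∪ blkB n ∪ blkC n := by
  rwa [bpot_rt, blk_rt]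

/-- **The biarcs `barc s 0`, `s ≤ n+1`, are residual or far-biarc-covered** (`s ∈ {0, 1, n−1, n, n+1}` residual, `2 ≤ s ≤ n−2` in `blkA`).
[folklore] -/
theorem nx_barc (h4 : 4 ≤ n) (s : ℕ) (hs : s ≤ n + 1) :
    bpot (c n) (barc 0 0) (barc (s : ZMod (2 * n)) 0) ≤ 1 ∨ blk (c n) (barc (s : ZMod (2 * n)) 0) ∈ blkA n ∪ blkB n ∪ blkC n := by
  by_cases h0 : s = 0
  · subst h0; left; rw [Nat.cast_zero, (bpot_diag (n := n) 0).1]; omega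
  by_cases h1 : s = 1
  · subst h1; left
    have h := (bpot_next_le_one (n := n) 0).2.1
    rw [zero_add] at h
    rwa [Nat.cast_one]
  by_cases hm : s ≤ n - 2
  · right
    exact mem_union_left _ (mem_union_left _ (mem_image.mpr ⟨s, mem_Ico.mpr ⟨by omega, by omega⟩, rfl⟩))
  by_cases h2 : s = n - 1
  · rw [h2]; left
    have h := (bpot_next_le_one (n := n) ((n - 1 : ℕ) : ZMod (2 * n))).2.2.1
    have e : ((n - 1 : ℕ) : ZMod (2 * n)) + 1 + (n : ZMod (2 * n)) = 0 := by
      rw [Nat.cast_sub (by omega), Nat.cast_one, sub_add_cancel, two_n_eq_zero]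
    rwa [e] at h
  by_cases h3 : s = n
  · rw [h3]; left
    have h := (bpot_diag (n := n) (n : ZMod (2 * n))).2
    rw [two_n_eq_zero] at h; omega
  · have h5 : s = n + 1 := by omega
    rw [h5]; left
    have h := (bpot_next_le_one (n := n) (n : ZMod (2 * n))).2.2.2
    rwa [two_n_eq_zero, ← Nat.cast_succ] at h

/-- The single flips of `T₀` are residual. [folklore] -/
theorem bpot_oflipCM_base_le_one {s : QuaternionGroup n} (hs : s ∈ (barc (0 : ZMod (2 * n)) 0).1) :
    bpot (c n) (barc 0 0) (oflipCM (c n) c_mul_c s (barc 0 0)) ≤ 1 := by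
  have h := bpot_oflipCM_rt_le_one (c n) (barc (0 : ZMod (2 * n)) 0) c_mul_c 1 (s := s) (by rwa [rt_one])
  rwa [rt_one] at h

/-- `a i ∈ T₀` for `i < n` and `xa j ∈ T₀` for `j < n`. [folklore] -/
theorem natCast_mem_base {i : ℕ} (hi : i < n) :
    (a (i : ZMod (2 * n)) : QuaternionGroup n) ∈ (barc (0 : ZMod (2 * n)) 0).1 ∧ (xa (i : ZMod (2 * n)) : QuaternionGroup n) ∈ (barc (0 : ZMod (2 * n)) 0).1 := by
  rw [a_mem_barc, xa_mem_barc, sub_zero, val_natCast_of_lt (by omega)]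
  exact ⟨hi, hi⟩

/-- The flip at the place of `xa (−1)` is the flip at `xa (n−1) ∈ T₀`, so it is residual too. [folklore] -/
theorem bpot_oflip_xa_neg_one_le_one : bpot (c n) (barc 0 0) (oflipCM (c n) c_mul_c (xa (-1)) (barc (0 : ZMod (2 * n)) 0)) ≤ 1 := by
  have hn := NeZero.ne n
  have e : (xa (((n - 1 : ℕ) : ℕ) : ZMod (2 * n)) : QuaternionGroup n) = c n * xa (-1) := by
    rw [(c_mul_a _).2, Nat.cast_sub (by omega), Nat.cast_one]; congr 1; ring
  have h := bpot_oflipCM_base_le_one (natCast_mem_base (n := n) (i := n - 1) (by omega)).2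
  rwa [e, oflipCM_cmul] at h

/-- The rotation coincidence blocks are explicitly covered. [folklore] -/
theorem blk_C_mem {i : ℕ} (h1 : 1 ≤ i) (h2 : i + 2 ≤ n) :
    blk (c n) (oflipCM (c n) c_mul_c (a 0) (oflipCM (c n) c_mul_c (a ((i : ZMod (2 * n)) + 1)) (barc 0 0))) ∈ blkA n ∪ blkB n ∪ blkC n :=
  mem_union_left _ (mem_union_right _ (mem_image.mpr ⟨i, mem_Ico.mpr ⟨h1, by omega⟩, rfl⟩))

/-- The reflection coincidence blocks are explicitly covered. [folklore] -/
theorem blk_C'_mem {j : ℕ} (h1 : 1 ≤ j) (h2 : j + 3 ≤ n) :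
    blk (c n) (oflipCM (c n) c_mul_c (a 0) (oflipCM (c n) c_mul_c (xa ((j : ZMod (2 * n)) + 1)) (barc 0 0))) ∈ blkA n ∪ blkB n ∪ blkC n :=
  mem_union_right _ (mem_image.mpr ⟨j, mem_Ico.mpr ⟨h1, by omega⟩, rfl⟩)

/-- The top reflection double flip `T₀^{(a 0)(xa (n−1))} = barc 1 (−1)` lies in the far biarc block `BA_2`. [folklore] -/
theorem blk_top_mem (h4 : 4 ≤ n) :
    blk (c n) (oflipCM (c n) c_mul_c (a 0) (oflipCM (c n) c_mul_c (xa (((n - 2 : ℕ) : ZMod (2 * n)) + 1)) (barc 0 0))) ∈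
      blkA n ∪ blkB n ∪ blkC n := by
  have e : (xa (((n - 2 : ℕ) : ZMod (2 * n)) + 1) : QuaternionGroup n) = c n * xa (-1) := by
    rw [(c_mul_a _).2, Nat.cast_sub (by omega), Nat.cast_two]; congr 1; ring
  rw [e, oflipCM_cmul, oflipCM_ends.2.2.2, oflipCM_a_barc, zero_add,
    show barc (1 : ZMod (2 * n)) (-1) = rt (c n) (a 1) (barc ((2 : ℕ) : ZMod (2 * n)) 0) by
      rw [rt_a_barc, Nat.cast_two, zero_sub]; norm_num, blk_rt]
  exact mem_union_left _ (mem_union_left _ (mem_image.mpr ⟨2, mem_Ico.mpr ⟨le_rfl, by omega⟩, rfl⟩))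

/-! ## §3 The block parities of the family vanish on the far set -/

/-- A face all four of whose corners are residual-or-explicit has zero parity on every far block. [folklore] -/
theorem par_gface_eq_zero_of_nx {Φ : CMF (QuaternionGroup n) (c n)} {t t' : QuaternionGroup n}
    (h0 : bpot (c n) (barc 0 0) Φ ≤ 1 ∨ blk (c n) Φ ∈ blkA n ∪ blkB n ∪ blkC n)
    (htt : bpot (c n) (barc 0 0) (oflipCM (c n) c_mul_c t (oflipCM (c n) c_mul_c t' Φ)) ≤ 1 ∨
      blk (c n) (oflipCM (c n) c_mul_c t (oflipCM (c n) c_mul_c t' Φ)) ∈ blkA n ∪ blkB n ∪ blkC n)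
    (ht : bpot (c n) (barc 0 0) (oflipCM (c n) c_mul_c t Φ) ≤ 1 ∨ blk (c n) (oflipCM (c n) c_mul_c t Φ) ∈ blkA n ∪ blkB n ∪ blkC n)
    (ht' : bpot (c n) (barc 0 0) (oflipCM (c n) c_mul_c t' Φ) ≤ 1 ∨ blk (c n) (oflipCM (c n) c_mul_c t' Φ) ∈ blkA n ∪ blkB n ∪ blkC n)
    {B : Block (c n)} (hB : 2 ≤ bpot (c n) (barc 0 0) B.out ∧ B ∉ blkA n ∪ blkB n ∪ blkC n) :
    par (c n) (gface (c n) c_mul_c Φ t t') B = 0 := by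
  rw [par_gface_apply, if_neg (blk_ne_of_nx h0 hB), if_neg (blk_ne_of_nx htt hB), if_neg (blk_ne_of_nx ht hB), if_neg (blk_ne_of_nx ht' hB)]
  ring

/-- **The block parities of `qfam` vanish on the far set** (`n ≥ 4`). [folklore] -/
theorem par_qfam_eq_zero_of_far (h4 : 4 ≤ n) {f : CMF (QuaternionGroup n) (c n) →₀ ℤ} (hf : f ∈ qfam n)
    (B : Block (c n)) (hB : 2 ≤ bpot (c n) (barc 0 0) B.out ∧ B ∉ blkA n ∪ blkB n ∪ blkC n) : par (c n) f B = 0 := by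
  have hT : bpot (c n) (barc 0 0) (barc (0 : ZMod (2 * n)) 0) ≤ 1 ∨ blk (c n) (barc (0 : ZMod (2 * n)) 0) ∈ blkA n ∪ blkB n ∪ blkC n := by
    left; rw [(bpot_diag (n := n) 0).1]; omega
  have hX : bpot (c n) (barc 0 0) (oflipCM (c n) c_mul_c (xa (-1)) (barc (0 : ZMod (2 * n)) 0)) ≤ 1 ∨
      blk (c n) (oflipCM (c n) c_mul_c (xa (-1)) (barc (0 : ZMod (2 * n)) 0)) ∈ blkA n ∪ blkB n ∪ blkC n := Or.inl bpot_oflip_xa_neg_one_le_one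
  have hA0 : bpot (c n) (barc 0 0) (oflipCM (c n) c_mul_c (a 0) (barc (0 : ZMod (2 * n)) 0)) ≤ 1 ∨
      blk (c n) (oflipCM (c n) c_mul_c (a 0) (barc (0 : ZMod (2 * n)) 0)) ∈ blkA n ∪ blkB n ∪ blkC n := by
    left; have h := bpot_oflipCM_base_le_one (natCast_mem_base (n := n) (i := 0) (by omega)).1; rwa [Nat.cast_zero] at h
  have hAi : ∀ i : ℕ, i < n → bpot (c n) (barc 0 0) (oflipCM (c n) c_mul_c (a (i : ZMod (2 * n))) (barc (0 : ZMod (2 * n)) 0)) ≤ 1 ∨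
      blk (c n) (oflipCM (c n) c_mul_c (a (i : ZMod (2 * n))) (barc (0 : ZMod (2 * n)) 0)) ∈ blkA n ∪ blkB n ∪ blkC n :=
    fun i hi => Or.inl (bpot_oflipCM_base_le_one (natCast_mem_base hi).1)
  have hXj : ∀ j : ℕ, j < n → bpot (c n) (barc 0 0) (oflipCM (c n) c_mul_c (xa (j : ZMod (2 * n))) (barc (0 : ZMod (2 * n)) 0)) ≤ 1 ∨
      blk (c n) (oflipCM (c n) c_mul_c (xa (j : ZMod (2 * n))) (barc (0 : ZMod (2 * n)) 0)) ∈ blkA n ∪ blkB n ∪ blkC n :=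
    fun j hj => Or.inl (bpot_oflipCM_base_le_one (natCast_mem_base hj).2)
  rw [qfam, mem_union, mem_union, mem_union, mem_union] at hf
  rcases hf with (hf | hf | hf) | hf | hf
  · -- biarc faces: corners `barc k 0`, `barc (k+1)(−1) = barc (k+2) 0·(a 1)⁻¹`, `barc (k+1) 0`, `barc k (−1) = barc (k+1) 0·(a 1)⁻¹`
    obtain ⟨k, hk, rfl⟩ := mem_image.mp hf
    rw [mem_range] at hk
    rw [fplus]
    refine par_gface_eq_zero_of_nx (nx_barc h4 k (by omega)) ?_ ?_ ?_ hB
    · rw [oflipCM_xa_last_barc, oflipCM_a_barc,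
        show barc ((k : ℕ) + 1 : ZMod (2 * n)) (0 - 1) = rt (c n) (a 1) (barc ((k + 2 : ℕ) : ZMod (2 * n)) 0) by
          rw [rt_a_barc]; congr 1; push_cast; ring]
      exact nx_rt (nx_barc h4 (k + 2) (by omega)) _
    · rw [oflipCM_a_barc, ← Nat.cast_succ]
      exact nx_barc h4 (k + 1) (by omega)
    · rw [oflipCM_xa_last_barc,
        show barc ((k : ℕ) : ZMod (2 * n)) (0 - 1) = rt (c n) (a 1) (barc ((k + 1 : ℕ) : ZMod (2 * n)) 0) by
          rw [rt_a_barc]; congr 1; push_cast; ring]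
      exact nx_rt (nx_barc h4 (k + 1) (by omega)) _
  · -- rotation chain faces `f_i`
    obtain ⟨i, hi, rfl⟩ := mem_image.mp hf
    rw [mem_Ico] at hi
    refine par_gface_eq_zero_of_nx hT ?_ (hAi i (by omega)) hX hB
    rw [← rt_a_one_oflip_a_zero_a]
    exact nx_rt (Or.inr (blk_C_mem hi.1 (by omega))) _
  · -- rotation chain covers `c_i`
    obtain ⟨i, hi, rfl⟩ := mem_image.mp hf
    rw [mem_Ico] at hi
    refine par_gface_eq_zero_of_nx hT (Or.inr (blk_C_mem hi.1 (by omega))) hA0 ?_ hB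
    rw [← Nat.cast_succ]
    exact hAi (i + 1) (by omega)
  · -- reflection chain faces `f'_j`
    obtain ⟨j, hj, rfl⟩ := mem_image.mp hf
    rw [mem_Ico] at hj
    refine par_gface_eq_zero_of_nx hT ?_ (hXj j (by omega)) hX hB
    rw [← rt_a_one_oflip_a_zero_xa]
    refine nx_rt ?_ _
    by_cases hjn : j + 3 ≤ n
    · exact Or.inr (blk_C'_mem hj.1 hjn)
    · have e : j = n - 2 := by omega
      subst e
      exact Or.inr (blk_top_mem h4)
  · -- reflection chain covers `c'_j`
    obtain ⟨j, hj, rfl⟩ := mem_image.mp hf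
    rw [mem_Ico] at hj
    refine par_gface_eq_zero_of_nx hT (Or.inr (blk_C'_mem hj.1 (by omega))) hA0 ?_ hB
    rw [← Nat.cast_succ]
    exact hXj (j + 1) (by omega)

end

end Summit.HodgeConjecture.CorCM.Census.QuaternionColumn
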